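import Summits.QuantumAdvantage.AdviceFreeQNC0.Elimination
import Literature.Computability.MetaComplexity.RobustHegedusLemma
import HarnessLib

/-!
# Cell qa-qnc0 (rung F-Q1, crux of record `TensorMultOneAt` = MULT₁ at one block size): the
# NORM-AGNOSTIC RUNGS of a SYMMETRIC last player (planner qa-qnc0-p1 Sketch13 v4 §DiversityRungs)

Planner qa-qnc0-p1 gen 13 (ROUND-12 §2.10(vi), fence F12.4, `HOME/qa-qnc0-p1/Sketch13.lean` v4): a
norm-agnostic induction on the tensor tower is worth exactly the covering LP, but RESTRICTED last players
— linear parts measurable w.r.t. a partition of the `m` coordinates into `s` blocks — pay the fractional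
packing number `V_s` in EVERY subadditive weight on an `𝔽₂`-group (`DiversityPays`, statements VERBATIM:
`blockPar`, `lastPlayerVal`, `DiversityPays`, `SymPaysEight`, `SymPaysFourteen`, `Div2222PaysEight`).

Proved here, the case `s = 1` (the SYMMETRIC last player, one block = all coordinates):

* `diversityPays_sym`: `DiversityPays m 1 (fun _ => univ) (min(N₀,N₂,N₄) + min(N₁,N₃,N₅))`, where
  `N_j = #{u ∈ {0,1}^m : |u| ≡ j (mod 6)}`.  The symmetric last player's value depends on `|u| mod 6`
  only; the three EVEN-parity classes `{0, 4, 2}` show `c₀, c₁, c₀+c₁+e`, which sum to `e` in a group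
  of exponent `2` (even-triple certificate), the three ODD-parity classes `{3, 1, 5}` show
  `c₀+g₀, c₁+g₁, c₀+c₁+e+g₀+g₁`, which also sum to `e` (odd-triple certificate); subadditivity.
* `symPaysEight : SymPaysEight` (`m = 8`: `29 + 16 = 45 = w(8,1)`, the planner's certificate
  `29·{even triple} + 16·{odd triple}`) and `symPaysFourteen : SymPaysFourteen` (`m = 14`:
  `2002 + 2366 = 4368 = w(14,1) > 4096 = 2¹⁴/4` — a symmetric last player pays MORE than the
  `TensorMultOneAt` threshold at every tower level); class counts by `N_j = Σ_{w ≡ j (6)} C(m, w)`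
  (`Hegedus.card_layer`).

WHAT THIS IS NOT: `Div2222PaysEight` (s = 4, LP certificate with 69 columns) is only STATED; nothing for
unrestricted last players (that is MULT₁ itself, OPEN); no bound on α; separation NOT moved.
-/

noncomputable section

namespace Summit.QuantumAdvantage.AdviceFreeQNC0

open Finset
open Literature.Computability.MetaComplexity

/-! ### Sketch13 v4 statements (verbatim) -/

section DiversityRungs

variable {m s : ℕ}

/-- Parity of `u` on a block of coordinates.  (Planner qa-qnc0-p1 Sketch13 v4, verbatim.) -/
def blockPar (I : Finset (Fin m)) (u : Fin m → Bool) : Bool :=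
  decide ((I.filter fun i => u i = true).card % 2 = 1)

/-- The value shown by a block-measurable last player at own-block content `u`, in an abstract
additive group `Q` (the quotient `𝔽₂^{N^k}/S_k` in the application): class `|u| mod 3 = 0` rows get
`c₀ + Σ_j π_j(u) g₀ j`, class 1 rows `c₁ + Σ_j π_j(u) g₁ j`, class 2 rows the sum of both plus `e`
(the affine-pair normal form, ROUND-12 §2.10(i)).  (Sketch13 v4, verbatim.) -/
def lastPlayerVal {Q : Type} [AddCommGroup Q] (blocks : Fin s → Finset (Fin m))
    (c₀ c₁ e : Q) (g₀ g₁ : Fin s → Q) (u : Fin m → Bool) : Q :=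
  let lin₀ : Q := ∑ j : Fin s, (if blockPar (blocks j) u then g₀ j else 0)
  let lin₁ : Q := ∑ j : Fin s, (if blockPar (blocks j) u then g₁ j else 0)
  if (univ.filter fun i : Fin m => u i = true).card % 3 = 0 then c₀ + lin₀
  else if (univ.filter fun i : Fin m => u i = true).card % 3 = 1 then c₁ + lin₁
  else c₀ + c₁ + e + lin₀ + lin₁

/-- NORM-AGNOSTIC MULTIPLIER of a block structure: in every additive group of exponent 2 with a
subadditive nonnegative weight, a last player measurable w.r.t. `blocks` pays at least `V·nrm e`.
(Sketch13 v4, verbatim.) -/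
def DiversityPays (m s : ℕ) (blocks : Fin s → Finset (Fin m)) (V : ℝ) : Prop :=
  ∀ (Q : Type) [AddCommGroup Q] (nrm : Q → ℝ),
    (∀ a b : Q, nrm (a + b) ≤ nrm a + nrm b) → (∀ a : Q, 0 ≤ nrm a) → (∀ x : Q, x + x = 0) →
    ∀ (c₀ c₁ e : Q) (g₀ g₁ : Fin s → Q),
      V * nrm e ≤ ∑ u : Fin m → Bool, nrm (lastPlayerVal blocks c₀ c₁ e g₀ g₁ u)

/-- Rung (s = 1, the symmetric last player; Steiner decoupling, certificate 29·{even triple} +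
16·{odd triple}): `V_1(8) = 45 = w(8,1)`.  (Sketch13 v4, verbatim; proved below.) -/
def SymPaysEight : Prop := DiversityPays 8 1 (fun _ => univ) 45

/-- Rung (s = 1 at the paying block size): `V_1(14) = 4368 = w(14,1) > 4096 = 2^14/4` — a symmetric
last player pays MORE than the `TensorMultOneAt` threshold at every tower level.  (Sketch13 v4,
verbatim; proved below.) -/
def SymPaysFourteen : Prop := DiversityPays 14 1 (fun _ => univ) 4368

/-- Rung (s = 4, m = 8, blocks (2,2,2,2); LP certificate with 69 columns, kit13/vs_partition.py).
(Sketch13 v4, verbatim; NOT proved in this file.) -/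
def Div2222PaysEight : Prop :=
  DiversityPays 8 4 (fun j => univ.filter fun i : Fin 8 => i.val / 2 = j.val) 45

end DiversityRungs

/-! ### The symmetric last player (`s = 1`) -/

namespace DiversityRungs

variable {m : ℕ}

/-- `N_j(m) = #{u ∈ {0,1}^m : |u| ≡ j (mod 6)}`. -/
def N6 (m j : ℕ) : ℕ := (univ.filter fun u : Fin m → Bool => wt u % 6 = j).card

/-- The six values of the symmetric last player, indexed by `|u| mod 6`. -/
def val6 {Q : Type} [AddCommGroup Q] (c₀ c₁ e a₀ a₁ : Q) (j : ℕ) : Q :=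
  if j = 0 then c₀ else if j = 1 then c₁ + a₁ else if j = 2 then c₀ + c₁ + e
  else if j = 3 then c₀ + a₀ else if j = 4 then c₁ else c₀ + c₁ + e + a₀ + a₁

/-- The symmetric last player's value is `val6` of `|u| mod 6`. -/
theorem lastPlayerVal_sym {Q : Type} [AddCommGroup Q] (c₀ c₁ e : Q) (g₀ g₁ : Fin 1 → Q)
    (u : Fin m → Bool) :
    lastPlayerVal (fun _ : Fin 1 => (univ : Finset (Fin m))) c₀ c₁ e g₀ g₁ u =
      val6 c₀ c₁ e (g₀ 0) (g₁ 0) (wt u % 6) := by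
  unfold lastPlayerVal blockPar val6
  simp only [Finset.univ_unique, Fin.default_eq_zero, Finset.sum_singleton]
  have hw : (univ.filter fun i : Fin m => u i = true).card = wt u := rfl
  rw [hw]
  have h6 : wt u % 6 < 6 := Nat.mod_lt _ (by norm_num)
  have h3 : wt u % 3 = wt u % 6 % 3 := by omega
  have h2 : wt u % 2 = wt u % 6 % 2 := by omega
  rw [h3, h2]
  generalize wt u % 6 = j at h6
  interval_cases j <;> simp

/-- The cost of the symmetric last player, summed by the classes `|u| mod 6`. -/
theorem sum_nrm_eq {Q : Type} [AddCommGroup Q] (nrm : Q → ℝ) (c₀ c₁ e : Q) (g₀ g₁ : Fin 1 → Q) :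
    ∑ u : Fin m → Bool, nrm (lastPlayerVal (fun _ : Fin 1 => (univ : Finset (Fin m))) c₀ c₁ e g₀ g₁ u) =
      ∑ j ∈ range 6, (N6 m j : ℝ) * nrm (val6 c₀ c₁ e (g₀ 0) (g₁ 0) j) := by
  simp_rw [lastPlayerVal_sym]
  rw [← sum_fiberwise_of_maps_to (s := (univ : Finset (Fin m → Bool))) (t := range 6)
    (g := fun u => wt u % 6) (fun u _ => mem_range.2 (Nat.mod_lt _ (by norm_num)))]
  refine Finset.sum_congr rfl fun j _ => ?_
  rw [Finset.sum_congr rfl fun u hu => by rw [(mem_filter.1 hu).2], Finset.sum_const, nsmul_eq_mul]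
  rfl

/-- **The symmetric rung, general `m`**: `DiversityPays m 1 (fun _ => univ) (min(N₀,N₂,N₄) + min(N₁,N₃,N₅))`
— even-triple certificate on the classes `{0,4,2}`, odd-triple certificate on `{3,1,5}`. -/
theorem diversityPays_sym (m : ℕ) :
    DiversityPays m 1 (fun _ => univ)
      (((min (min (N6 m 0) (N6 m 2)) (N6 m 4) + min (min (N6 m 1) (N6 m 3)) (N6 m 5) : ℕ) : ℝ)) := by
  intro Q _ nrm hsub hnn h2 c₀ c₁ e g₀ g₁
  rw [sum_nrm_eq]
  simp only [Finset.sum_range_succ, Finset.sum_range_zero, zero_add]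
  set a₀ := g₀ 0
  set a₁ := g₁ 0
  -- the six values
  have v0 : val6 c₀ c₁ e a₀ a₁ 0 = c₀ := by simp [val6]
  have v1 : val6 c₀ c₁ e a₀ a₁ 1 = c₁ + a₁ := by simp [val6]
  have v2 : val6 c₀ c₁ e a₀ a₁ 2 = c₀ + c₁ + e := by simp [val6]
  have v3 : val6 c₀ c₁ e a₀ a₁ 3 = c₀ + a₀ := by simp [val6]
  have v4 : val6 c₀ c₁ e a₀ a₁ 4 = c₁ := by simp [val6]
  have v5 : val6 c₀ c₁ e a₀ a₁ 5 = c₀ + c₁ + e + a₀ + a₁ := by simp [val6]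
  rw [v0, v1, v2, v3, v4, v5]
  -- the two certificates
  have hsub3 : ∀ x y z : Q, nrm (x + y + z) ≤ nrm x + nrm y + nrm z :=
    fun x y z => (hsub _ _).trans (by linarith [hsub x y])
  have heven : nrm e ≤ nrm c₀ + nrm c₁ + nrm (c₀ + c₁ + e) := by
    have : c₀ + c₁ + (c₀ + c₁ + e) = e := by
      have := h2 c₀; have := h2 c₁
      calc c₀ + c₁ + (c₀ + c₁ + e) = (c₀ + c₀) + (c₁ + c₁) + e := by abel
        _ = e := by rw [h2 c₀, h2 c₁, zero_add, zero_add]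
    calc nrm e = nrm (c₀ + c₁ + (c₀ + c₁ + e)) := by rw [this]
      _ ≤ _ := hsub3 _ _ _
  have hodd : nrm e ≤ nrm (c₀ + a₀) + nrm (c₁ + a₁) + nrm (c₀ + c₁ + e + a₀ + a₁) := by
    have : (c₀ + a₀) + (c₁ + a₁) + (c₀ + c₁ + e + a₀ + a₁) = e := by
      calc (c₀ + a₀) + (c₁ + a₁) + (c₀ + c₁ + e + a₀ + a₁)
          = (c₀ + c₀) + (c₁ + c₁) + (a₀ + a₀) + (a₁ + a₁) + e := by abel
        _ = e := by rw [h2 c₀, h2 c₁, h2 a₀, h2 a₁]; abel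
    calc nrm e = nrm ((c₀ + a₀) + (c₁ + a₁) + (c₀ + c₁ + e + a₀ + a₁)) := by rw [this]
      _ ≤ _ := hsub3 _ _ _
  -- class sizes versus the two minima
  set ME := min (min (N6 m 0) (N6 m 2)) (N6 m 4) with hME
  set MO := min (min (N6 m 1) (N6 m 3)) (N6 m 5) with hMO
  have e0 : (ME : ℝ) ≤ N6 m 0 := by exact_mod_cast (min_le_left _ _).trans (min_le_left _ _)
  have e2 : (ME : ℝ) ≤ N6 m 2 := by exact_mod_cast (min_le_left _ _).trans (min_le_right _ _)
  have e4 : (ME : ℝ) ≤ N6 m 4 := by exact_mod_cast min_le_right _ _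
  have o1 : (MO : ℝ) ≤ N6 m 1 := by exact_mod_cast (min_le_left _ _).trans (min_le_left _ _)
  have o3 : (MO : ℝ) ≤ N6 m 3 := by exact_mod_cast (min_le_left _ _).trans (min_le_right _ _)
  have o5 : (MO : ℝ) ≤ N6 m 5 := by exact_mod_cast min_le_right _ _
  have n0 := hnn c₀; have n1 := hnn (c₁ + a₁); have n2 := hnn (c₀ + c₁ + e)
  have n3 := hnn (c₀ + a₀); have n4 := hnn c₁; have n5 := hnn (c₀ + c₁ + e + a₀ + a₁)
  have hME0 : (0 : ℝ) ≤ ME := Nat.cast_nonneg _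
  have hMO0 : (0 : ℝ) ≤ MO := Nat.cast_nonneg _
  push_cast
  nlinarith [mul_le_mul_of_nonneg_right e0 n0, mul_le_mul_of_nonneg_right e2 n2,
    mul_le_mul_of_nonneg_right e4 n4, mul_le_mul_of_nonneg_right o1 n1,
    mul_le_mul_of_nonneg_right o3 n3, mul_le_mul_of_nonneg_right o5 n5,
    mul_le_mul_of_nonneg_left heven hME0, mul_le_mul_of_nonneg_left hodd hMO0]

/-- `DiversityPays` is monotone in the multiplier. -/
theorem diversityPays_mono {s : ℕ} {blocks : Fin s → Finset (Fin m)} {V V' : ℝ} (hV : V' ≤ V)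
    (h : DiversityPays m s blocks V) : DiversityPays m s blocks V' := by
  intro Q _ nrm hsub hnn h2 c₀ c₁ e g₀ g₁
  exact le_trans (mul_le_mul_of_nonneg_right hV (hnn e)) (h Q nrm hsub hnn h2 c₀ c₁ e g₀ g₁)

/-! ### The class counts `N_j(m) = Σ_{w ≡ j (6)} C(m, w)` -/

/-- `N_j(m)` as a sum of binomial coefficients. -/
theorem N6_eq_sum_choose (m j : ℕ) :
    N6 m j = ∑ w ∈ (range (m + 1)).filter (fun w => w % 6 = j), m.choose w := by
  unfold N6
  rw [card_eq_sum_card_fiberwise (f := fun u : Fin m → Bool => wt u) (t := (range (m + 1)).filter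
    (fun w => w % 6 = j)) (fun u hu => ?_)]
  · refine Finset.sum_congr rfl fun w hw => ?_
    have hwj : w % 6 = j := (mem_filter.1 hw).2
    rw [← Hegedus.card_layer m w]
    congr 1
    ext u
    simp only [mem_filter, mem_univ, true_and, Hegedus.layer, Hegedus.wt, wt]
    constructor
    · rintro ⟨_, h⟩; exact h
    · intro h; exact ⟨by rw [h]; exact hwj, h⟩
  · simp only [Finset.coe_filter, Set.mem_setOf_eq, mem_range, mem_univ, true_and] at hu ⊢
    refine ⟨Nat.lt_succ_of_le ?_, hu⟩
    unfold wt
    exact (card_le_univ _).trans (by rw [Fintype.card_fin])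

/-- The class counts at `m = 8`: `(29, 16, 29, 56, 70, 56)`. -/
theorem N6_eight : N6 8 0 = 29 ∧ N6 8 1 = 16 ∧ N6 8 2 = 29 ∧ N6 8 3 = 56 ∧ N6 8 4 = 70 ∧ N6 8 5 = 56 := by
  refine ⟨?_, ?_, ?_, ?_, ?_, ?_⟩ <;> rw [N6_eq_sum_choose] <;> decide

/-- The class counts at `m = 14`: `(3095, 3460, 3095, 2366, 2002, 2366)`. -/
theorem N6_fourteen : N6 14 0 = 3095 ∧ N6 14 1 = 3460 ∧ N6 14 2 = 3095 ∧ N6 14 3 = 2366 ∧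
    N6 14 4 = 2002 ∧ N6 14 5 = 2366 := by
  refine ⟨?_, ?_, ?_, ?_, ?_, ?_⟩ <;> rw [N6_eq_sum_choose] <;> decide

end DiversityRungs

open DiversityRungs

/-- **`SymPaysEight` — PROVED**: `V_1(8) = 45` (`min(29,29,70) + min(16,56,56) = 29 + 16`). -/
theorem symPaysEight : SymPaysEight := by
  have h := diversityPays_sym 8
  obtain ⟨h0, h1, h2, h3, h4, h5⟩ := N6_eight
  rw [h0, h1, h2, h3, h4, h5] at h
  norm_num at h
  exact h

/-- **`SymPaysFourteen` — PROVED**: `V_1(14) = 4368 = 2002 + 2366 > 4096 = 2¹⁴/4`. -/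
theorem symPaysFourteen : SymPaysFourteen := by
  have h := diversityPays_sym 14
  obtain ⟨h0, h1, h2, h3, h4, h5⟩ := N6_fourteen
  rw [h0, h1, h2, h3, h4, h5] at h
  norm_num at h
  exact h

end Summit.QuantumAdvantage.AdviceFreeQNC0
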